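import Summits.ValiantsHypothesis.ValiantsHypothesis.Theorems.BarrierLeverChowHitsPartitionMinorsRFacePrivateDesign
import Summits.ValiantsHypothesis.ValiantsHypothesis.Theorems.BarrierLeverChowHitsPartitionMinorsRLowerSets
import Summits.ValiantsHypothesis.ValiantsHypothesis.Theorems.BarrierLeverPartitionMinorsChowSwap

/-!
# Route BarrierLever — item `ChowHitsPartitionMinorsR` (stmt-ValiantsHypothesis-21882):
# THIN PAIRS — every layout with `‖u‖ + h ≤ h·h` or `‖w‖ + h ≤ h·h` is hit by `h·h` affine forms

Helper file (`--supports stmt-ValiantsHypothesis-21882`; cell valiant-natproofs, rung V4, 𝒟-side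
support item of route BarrierLever; prover seat val-np-p5 gen 29). Definition-free. Closes NO item.
THEOREM FP (`ChowFacePrivate.chowHits_of_lowerRows`, file `…FacePrivateDesign`) composed with the
`x ↔ y` flip (`chow_hit_swap_fin`, pattern of `ChowFactor.chow_hit_swap`) and the one-sided
down-compression of the rows (`ChowLowerSets.iterate_x`, `h` extra factors):

* `chow_hit_swap_fin` — the `x ↔ y` flip for products of any number `m` of affine forms;
* **`exists_chow_of_thinLowerSets`** (arrow G2 of planner p1 g24, STATUS l.1767) — every injective
  LOWER-SET pair with `‖v‖ + 2h ≤ h·h ∨ ‖w'‖ + 2h ≤ h·h` (`‖v‖ = Σ_i |v i|`) is hit by `m` forms for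
  some `m` with `m + 2h ≤ h·h` (no compression needed);
* `chowHits_of_colTotalSize_le` — every injective layout with `Σ_j |w j| + h ≤ h·h` is hit by `h·h`
  affine forms (every height `h`);
* **`chowHits_of_thin`** (arrow G1) — every injective layout with `‖u‖ + h ≤ h·h ∨ ‖w‖ + h ≤ h·h`
  is hit by `h·h` affine forms. With this the residual node of item 21882 is the THICK-PAIRS statement
  (both total sizes `> h·h − h`; for lower-set pairs, via `ChowLowerSets.chowHitsPartitionMinorsR_of_
  lowerSets`, both `> h·h − 2h`).

WHAT THIS IS NOT: item 21882 is NOT proved; nothing on crux stmt-ValiantsHypothesis-14610 or on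
`VP` versus `VNP`.
-/

set_option linter.dupNamespace false

namespace Summit.ValiantsHypothesis.ValiantsHypothesis.Theorems.BarrierLever.ChowFacePrivate

open Finset MvPolynomial
open Summit.ValiantsHypothesis.ValiantsHypothesis.Theorems.BarrierLever.ChowFactor
  (mapDomain_flip_partitionExpo)
open Summit.ValiantsHypothesis.ValiantsHypothesis.Theorems.BarrierLever.ChowLowerSets
  (iterate_x exists_chow_fin_of_le)

noncomputable section

variable {h r : ℕ}

/-! ## 1. The `x ↔ y` flip and arrow G2 -/

/-- **Row/column swap for products of `m` affine forms** (the flip `x_a ↔ y_a`; pattern of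
`ChowFactor.chow_hit_swap`, which is the case `m = h + h`). -/
theorem chow_hit_swap_fin {m : ℕ} (u w : Fin r → Finset (Fin h))
    (hhit : ∃ ℓ : Fin m → MvPolynomial (Fin (h + h)) ℂ, (∀ q, (ℓ q).totalDegree ≤ 1) ∧
      (Matrix.of fun i j : Fin r => coeff
        (∑ b ∈ w i, Finsupp.single (Fin.castAdd h b) 1 + ∑ d ∈ u j, Finsupp.single (Fin.natAdd h d) 1)
        (∏ q, ℓ q)).det ≠ 0) :
    ∃ ℓ : Fin m → MvPolynomial (Fin (h + h)) ℂ, (∀ q, (ℓ q).totalDegree ≤ 1) ∧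
      (Matrix.of fun i j : Fin r => coeff
        (∑ b ∈ u i, Finsupp.single (Fin.castAdd h b) 1 + ∑ d ∈ w j, Finsupp.single (Fin.natAdd h d) 1)
        (∏ q, ℓ q)).det ≠ 0 := by
  classical
  obtain ⟨ℓ, hdeg, hdet⟩ := hhit
  set φ : Fin (h + h) ≃ Fin (h + h) :=
    finSumFinEquiv.symm.trans ((Equiv.sumComm (Fin h) (Fin h)).trans finSumFinEquiv) with hφ
  refine ⟨fun q => rename φ (ℓ q), fun q => (totalDegree_rename_le _ _).trans (hdeg q), ?_⟩
  have hprod : (∏ q, rename φ (ℓ q)) = rename φ (∏ q, ℓ q) := by rw [map_prod]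
  have hM : (Matrix.of fun i j : Fin r => coeff
      (∑ b ∈ u i, Finsupp.single (Fin.castAdd h b) 1 + ∑ d ∈ w j, Finsupp.single (Fin.natAdd h d) 1)
      (∏ q, rename φ (ℓ q))) =
      (Matrix.of fun i j : Fin r => coeff
        (∑ b ∈ w i, Finsupp.single (Fin.castAdd h b) 1 + ∑ d ∈ u j, Finsupp.single (Fin.natAdd h d) 1)
        (∏ q, ℓ q)).transpose := by
    ext i j
    rw [Matrix.of_apply, Matrix.transpose_apply, Matrix.of_apply, hprod,
      ← mapDomain_flip_partitionExpo (u i) (w j), coeff_rename_mapDomain _ φ.injective]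
  rw [hM, Matrix.det_transpose]
  exact hdet

/-- **Arrow G2 (planner p1 g24): THIN LOWER-SET PAIRS, no compression.** Every injective lower-set
pair one of whose families has total size `‖·‖ + 2h ≤ h·h` is hit by `m` affine forms for some `m`
with `m + 2h ≤ h·h`. -/
theorem exists_chow_of_thinLowerSets (h r : ℕ) (v w' : Fin r → Finset (Fin h))
    (hv : Function.Injective v) (hw : Function.Injective w')
    (hlv : IsLowerSet (Set.range v)) (hlw : IsLowerSet (Set.range w'))
    (hthin : (∑ i, (v i).card) + 2 * h ≤ h * h ∨ (∑ j, (w' j).card) + 2 * h ≤ h * h) :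
    ∃ m : ℕ, m + 2 * h ≤ h * h ∧ ∃ ℓ : Fin m → MvPolynomial (Fin (h + h)) ℂ,
      (∀ k, (ℓ k).totalDegree ≤ 1) ∧
      (Matrix.of fun i j : Fin r => MvPolynomial.coeff (∑ a ∈ v i, Finsupp.single (Fin.castAdd h a) 1 +
          ∑ c ∈ w' j, Finsupp.single (Fin.natAdd h c) 1) (∏ k, ℓ k)).det ≠ 0 := by
  rcases hthin with hV | hW
  · exact ⟨∑ i, (v i).card, hV, chow_hit_swap_fin v w'
      (chowHits_of_lowerRows w' v hw hv (fun i S hS => exists_row_of_subset w' hlw i S hS))⟩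
  · exact ⟨∑ j, (w' j).card, hW,
      chowHits_of_lowerRows v w' hv hw (fun i S hS => exists_row_of_subset v hlv i S hS)⟩

/-! ## 2. One-sided compression and arrow G1 -/

/-- **Every layout whose column family has total size `≤ h·h − h` is hit by `h·h` affine forms**
(THEOREM FP after down-compressing the rows, `ChowLowerSets.iterate_x`; at every height `h`). -/
theorem chowHits_of_colTotalSize_le (h r : ℕ) (u w : Fin r → Finset (Fin h))
    (hu : Function.Injective u) (hw : Function.Injective w)
    (hsize : ∑ j, (w j).card + h ≤ h * h) :
    ∃ ℓ : Fin (h * h) → MvPolynomial (Fin (h + h)) ℂ, (∀ k, (ℓ k).totalDegree ≤ 1) ∧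
      (Matrix.of fun i j : Fin r => MvPolynomial.coeff (∑ a ∈ u i, Finsupp.single (Fin.castAdd h a) 1 +
          ∑ c ∈ w j, Finsupp.single (Fin.natAdd h c) 1) (∏ k, ℓ k)).det ≠ 0 := by
  -- lower-set rows against the ACTUAL columns `w`, then all row compressions
  have hyp : ∀ v : Fin r → Finset (Fin h), Function.Injective v → IsLowerSet (Set.range v) →
      ∃ ℓ : Fin (∑ j, (w j).card) → MvPolynomial (Fin (h + h)) ℂ, (∀ k, (ℓ k).totalDegree ≤ 1) ∧
        (Matrix.of fun i j : Fin r => MvPolynomial.coeff (∑ a ∈ v i, Finsupp.single (Fin.castAdd h a) 1 +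
          ∑ c ∈ w j, Finsupp.single (Fin.natAdd h c) 1) (∏ k, ℓ k)).det ≠ 0 :=
    fun v hv hlv => chowHits_of_lowerRows v w hv hw (fun i S hS => exists_row_of_subset v hlv i S hS)
  obtain ⟨ℓ, hℓ, hdet⟩ := iterate_x w (∑ j, (w j).card) hyp h le_rfl u hu
    (fun a ha => absurd ha (by omega))
  obtain ⟨ℓ', hℓ', hprod⟩ := exists_chow_fin_of_le (M := h * h) hsize ℓ hℓ
  exact ⟨ℓ', hℓ', by rw [hprod]; exact hdet⟩

/-- **Arrow G1 (planner p1 g24): THIN PAIRS.** Every injective layout one of whose families has total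
size `‖·‖ + h ≤ h·h` is hit by `h·h` affine forms (every height; `h₁ = 0`). -/
theorem chowHits_of_thin (h r : ℕ) (u w : Fin r → Finset (Fin h))
    (hu : Function.Injective u) (hw : Function.Injective w)
    (hthin : (∑ i, (u i).card) + h ≤ h * h ∨ (∑ j, (w j).card) + h ≤ h * h) :
    ∃ ℓ : Fin (h * h) → MvPolynomial (Fin (h + h)) ℂ, (∀ k, (ℓ k).totalDegree ≤ 1) ∧
      (Matrix.of fun i j : Fin r => MvPolynomial.coeff (∑ a ∈ u i, Finsupp.single (Fin.castAdd h a) 1 +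
          ∑ c ∈ w j, Finsupp.single (Fin.natAdd h c) 1) (∏ k, ℓ k)).det ≠ 0 := by
  rcases hthin with hU | hW
  · exact chow_hit_swap_fin u w (chowHits_of_colTotalSize_le h r w u hw hu hU)
  · exact chowHits_of_colTotalSize_le h r u w hu hw hW

end

end Summit.ValiantsHypothesis.ValiantsHypothesis.Theorems.BarrierLever.ChowFacePrivate
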